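import Mathlib
import HarnessLib
import Summits.HubbardSuperconductivity.HubbardSuperconductivity.Theorems.KLProgrammeKLRegimeSplitFrameLemmas

/-!
# Route `KLProgramme` — definitions: the SEGMENT between two frames (`faffine t K₀ K₁ = (1 − t)·K₀ + t·K₁` in `TrigPolyC4v`) and the
# 2×-slackened admissible class `FrameOK₂` (name of record, plan g19 (R59s))

Cell `gate-hubbard-kl`, seat hubbard-kl-k3c3-p3 (g8; row «implicit-function / monotonicity route for μ(n)»); engine-flow child
`KLRegimeEngineV17F2` (stmt-HubbardSuperconductivity-20437), stub (C) `stub_twoLeg_curvature`, located risk «(C)-B-REP» / (SEG)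
(KL STATUS l.3431 (R59d), l.3502 (R59s), l.3518 (R59v)(D): E1's TOWER-LIPSCHITZ (F) = YES ⇒ «k3c3-p3 types the reviewed `def faffine (t)
(A B : TrigPolyC4v)` + `eval_faffine/evalM_faffine` and the kernel-lane `frameOK_faffine`»; p2 g12 l.3496: the lower bounds of `FrameOK`'s
clause (i) are not convex in `K` ⇒ the slackened class `FrameOK₂ R U N μ K := GeomConstants (frameLevel μ K) 7 (3/160) (1/4) (3/400) ∧
<the same jet clause>`).  `TrigPolyC4v` has no scalar multiple, so the segment is defined on the zero-extended coefficient tables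
(`coeffExt`, as `fsub`):
* `faffine t A B` — degree `max`, coefficients `(1 − t)·coeffExt A + t·coeffExt B`; `eval_faffine`, `evalM_faffine(_eq)`: it EVALUATES to
  the affine combination `(1 − t)·A(p) + t·B(p)` (so `frameLevel μ (faffine t K₀ K₁) = (1 − t)·e_{K₀} + t·e_{K₁}`);
* `FrameOK₂ R U N μ K` — verbatim `FrameOK` (…KLRegimeSplitPredicates §5) with the geometric constants `(7, 3/80, 1/2, 3/200)` replaced by
  `(7, 3/160, 1/4, 3/400)`; the jet clause (ii) is unchanged.
The theorems (`frameOK_faffine`: the FULL class is kept along the segment under the regime's smallness sums, via p2's `frameOK_of_pieces`;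
`frameOK₂_faffine`: the slackened class under a `C²`-distance hypothesis only; `FrameOK.frameOK₂`) are in the companion
`…KLRegimeSplitFrameSegment`.  Definitions only; nothing here asserts anything about the Hubbard model.
-/

noncomputable section

namespace Summit.HubbardSuperconductivity.HubbardSuperconductivity.Theorems.KLRegimeSplit

set_option linter.dupNamespace false -- summit = problem name (single-conjunct summit), D-0017

open Real Finset Literature.MathematicalPhysics.QuantumLattice Literature.MathematicalPhysics.QuantumLattice.FermiRG
open Summit.HubbardSuperconductivity.HubbardSuperconductivity.Theorems.DispersionFlow

/-! ## §1 The segment between two frames -/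

/-- **The affine combination of two frames**, `(1 − t)·A + t·B`: degree the max, coefficients the affine combination of the
zero-extended tables (`t = 0` evaluates to `A`, `t = 1` to `B`; `t ∈ [0, 1]` is the segment the corrected (B) door interpolates along). -/
def faffine (t : ℝ) (A B : TrigPolyC4v) : TrigPolyC4v :=
  ⟨max A.degree B.degree, fun m n => (1 - t) * coeffExt A m n + t * coeffExt B m n⟩

/-- **`(faffine t A B)(p) = (1 − t)·A(p) + t·B(p)`.** -/
theorem eval_faffine (t : ℝ) (A B : TrigPolyC4v) (p : Fin 2 → ℝ) :
    (faffine t A B).eval p = (1 - t) * A.eval p + t * B.eval p := by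
  rw [TrigPolyC4v.eval_def]
  show ∑ m ∈ range (max A.degree B.degree + 1), ∑ n ∈ range (max A.degree B.degree + 1),
      ((1 - t) * coeffExt A m n + t * coeffExt B m n) * TrigPolyC4v.harmonic m n p = (1 - t) * A.eval p + t * B.eval p
  simp only [add_mul, sum_add_distrib, mul_assoc, ← mul_sum]
  rw [sum_coeffExt_mul_eq_eval A (le_max_left _ _), sum_coeffExt_mul_eq_eval B (le_max_right _ _)]

/-- The segment on `Momentum`. -/
theorem evalM_faffine (t : ℝ) (A B : TrigPolyC4v) (q : Momentum) :
    evalM (faffine t A B) q = (1 - t) * evalM A q + t * evalM B q :=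
  eval_faffine t A B _

/-- The segment as a function on `Momentum`: `evalM (faffine t A B) = (1 − t) • evalM A + t • evalM B`. -/
theorem evalM_faffine_eq (t : ℝ) (A B : TrigPolyC4v) : evalM (faffine t A B) = (1 - t) • evalM A + t • evalM B := by
  funext q
  simp only [evalM_faffine, Pi.add_apply, Pi.smul_apply, smul_eq_mul]

/-- Endpoint `t = 0`: the segment evaluates to `A`. -/
theorem eval_faffine_zero (A B : TrigPolyC4v) (p : Fin 2 → ℝ) : (faffine 0 A B).eval p = A.eval p := by
  rw [eval_faffine]; ring

/-- Endpoint `t = 1`: the segment evaluates to `B`. -/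
theorem eval_faffine_one (A B : TrigPolyC4v) (p : Fin 2 → ℝ) : (faffine 1 A B).eval p = B.eval p := by
  rw [eval_faffine]; ring

/-- The segment is the start frame plus `t` times the difference: `(faffine t A B)(p) = A(p) + t·((B ⊖ A)(p))`. -/
theorem eval_faffine_eq_add_fsub (t : ℝ) (A B : TrigPolyC4v) (p : Fin 2 → ℝ) :
    (faffine t A B).eval p = A.eval p + t * (fsub B A).eval p := by
  rw [eval_faffine, eval_fsub]; ring

/-- The frame band along the segment is the affine combination of the endpoint bands:
`frameLevel μ (faffine t K₀ K₁) q = (1 − t)·frameLevel μ K₀ q + t·frameLevel μ K₁ q`. -/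
theorem frameLevel_faffine (μ t : ℝ) (K₀ K₁ : TrigPolyC4v) (q : Momentum) :
    frameLevel μ (faffine t K₀ K₁) q = (1 - t) * frameLevel μ K₀ q + t * frameLevel μ K₁ q := by
  simp only [frameLevel, eval_faffine]; ring

/-! ## §2 The 2×-slackened admissible class -/

/-- **`FrameOK₂ R U N μ K`** (name of record, plan g19 (R59s)): `FrameOK` with the geometric constants of clause (i) slackened by a
factor `2` — `GeomConstants e_K 7 (3/160) (1/4) (3/400)` (all derivatives of order `≤ 2` bounded by `7`, `|∇e_K| ≥ 1/4` and tangential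
Hessian `≥ (3/400)|t|²` on `{|e_K| < 3/160}`) — and the SAME jet clause (ii): `K` is the sum of `N + 1` pieces with
`‖Dʲ(Kp n)‖ ≤ Gfr j · uPow j U · 4^{(j−2)n}`, `j ≤ 4`.  The class in which the corrected (B) door reads the tower along a segment
`faffine t K₀ K₁` between two `FrameOK` frames (`frameOK₂_faffine`); every `FrameOK` frame is in it (`FrameOK.frameOK₂`). -/
def FrameOK₂ (R : RenConsts) (U : ℝ) (N : ℕ) (μ : ℝ) (K : TrigPolyC4v) : Prop :=
  GeomConstants (frameLevel μ K) 7 (3 / 160) (1 / 4) (3 / 400) ∧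
  ∃ Kp : ℕ → TrigPolyC4v,
    (∀ p : Fin 2 → ℝ, K.eval p = ∑ n ∈ range (N + 1), (Kp n).eval p) ∧
    ∀ n ≤ N, ∀ j ≤ 4, ∀ q : Momentum,
      ‖iteratedFDeriv ℝ j (evalM (Kp n)) q‖ ≤ R.Gfr j * uPow j U * (4 : ℝ) ^ (((j : ℤ) - 2) * n)

end Summit.HubbardSuperconductivity.HubbardSuperconductivity.Theorems.KLRegimeSplit

end
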